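import Summits.Ventures.PercRepro.C025ProfileOneFlat
import Summits.Ventures.PercRepro.RankLevelSetRuleQModelMatroid

/-!
# «`U_{r,n}` WITH ONE FAT FLAT», AS AN EXPLICIT MATROID: THE SECOND ROW AND C-025 AT `(r, r−2)` ON night-1's MODEL (night-3 g24)

`proofs/NIGHT3-G24-ONEFLAT.md` §3.  night-1 g14's `modelMatroid hE F s r` is the truncation `T_r(U_{s,F} ⊕ U_{E∖F, E∖F})` —
a uniform matroid of rank `r` on `E` with the fat flat `F` of rank `s` (rank function `min(min(#(X ∩ F), s) + #(X ∖ F), r)`,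
`modelMatroid_eRk`).  Feeding it to `OneFlat.profileIneq_second_of_uniformFlat` / `OneFlat.rls_of_uniformFlat` gives, for
`s ≤ #F`, `s ≤ r`: the row `(q, r−1)` of (Π) for `q + 2 ≤ r`, `r + q ≤ s + #(E ∖ F)`, and C-025 at `(r, r−2)` for
`2r − 2 ≤ s + #(E ∖ F)` — on an explicit matroid, no hypothesis left.
* `modelMatroid_gr_eq`, `modelMatroid_eRk_finset` — the ground set and the rank formula in the `Finset` vocabulary;
* **`profileIneq_second_modelMatroid`**, **`rls_modelMatroid`**.
No `def`, no `instance`, no notation.  Axioms: standard.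
-/

open scoped Matroid

namespace PercRepro

open Finset ThmH

namespace OneFlat

variable {α : Type} [DecidableEq α]

/-- **THE SECOND ROW `(q, r−1)` OF (Π) ON night-1's MODEL** `T_r(U_{s,F} ⊕ U_{E∖F,E∖F})` for `s ≤ #F`, `s ≤ r`, `q + 2 ≤ r`,
`r + q ≤ s + #(E ∖ F)`. -/
theorem profileIneq_second_modelMatroid {E : Set α} (hE : E.Finite) {F : Set α} (hF : F ⊆ E) {s r : ℕ}
    (hsr : s ≤ r) (hsF : s ≤ F.ncard) (q : ℕ) (hq : q + 2 ≤ r) (hreg : r + q ≤ s + (E \ F).ncard) :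
    haveI := modelMatroid_finite hE F s r
    Profile.ProfileIneq (modelMatroid hE F s r) q (r - 1) := by
  classical
  haveI := modelMatroid_finite hE F s r
  have hgr : ((gr (modelMatroid hE F s r) : Finset α) : Set α) = E := by
    rw [coe_gr, modelMatroid_E]
  have hE₁coe : (((gr (modelMatroid hE F s r)).filter (fun x => x ∈ F) : Finset α) : Set α) = F := by
    ext x
    simp only [coe_filter, Set.mem_setOf_eq]
    constructor
    · exact fun h => h.2
    · intro hx
      refine ⟨?_, hx⟩
      rw [← mem_coe, hgr]
      exact hF hx
  have hE₂coe : (((gr (modelMatroid hE F s r)).filter (fun x => x ∉ F) : Finset α) : Set α) = E \ F := by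
    ext x
    simp only [coe_filter, Set.mem_setOf_eq, Set.mem_sdiff]
    rw [← mem_coe, hgr]
  have hunion : gr (modelMatroid hE F s r) =
      (gr (modelMatroid hE F s r)).filter (fun x => x ∈ F) ∪ (gr (modelMatroid hE F s r)).filter (fun x => x ∉ F) :=
    (filter_union_filter_not_eq _ _).symm
  have hdisj : Disjoint ((gr (modelMatroid hE F s r)).filter (fun x => x ∈ F))
      ((gr (modelMatroid hE F s r)).filter (fun x => x ∉ F)) := disjoint_filter_filter_not _ _ _
  have hcard₁ : ((gr (modelMatroid hE F s r)).filter (fun x => x ∈ F)).card = F.ncard := by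
    rw [← Set.ncard_coe_finset, hE₁coe]
  have hcard₂ : ((gr (modelMatroid hE F s r)).filter (fun x => x ∉ F)).card = (E \ F).ncard := by
    rw [← Set.ncard_coe_finset, hE₂coe]
  have hrk : ∀ X : Finset α, X ⊆ gr (modelMatroid hE F s r) →
      (modelMatroid hE F s r).eRk (X : Set α) =
        ((min r (min (X ∩ (gr (modelMatroid hE F s r)).filter (fun x => x ∈ F)).card s +
          (X ∩ (gr (modelMatroid hE F s r)).filter (fun x => x ∉ F)).card) : ℕ) : ℕ∞) := by
    intro X hX
    have hXE : (X : Set α) ⊆ E := by rw [← hgr]; exact_mod_cast hX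
    rw [modelMatroid_eRk hE F hsr hXE]
    congr 1
    have h1 : ((X : Set α) ∩ F).ncard = (X ∩ (gr (modelMatroid hE F s r)).filter (fun x => x ∈ F)).card := by
      rw [← Set.ncard_coe_finset, coe_inter, hE₁coe]
    have h2 : ((X : Set α) \ F).ncard = (X ∩ (gr (modelMatroid hE F s r)).filter (fun x => x ∉ F)).card := by
      rw [← Set.ncard_coe_finset, coe_inter, hE₂coe]
      congr 1
      ext x
      simp only [Set.mem_sdiff, Set.mem_inter_iff]
      constructor
      · exact fun h => ⟨h.1, hXE h.1, h.2⟩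
      · exact fun h => ⟨h.1, h.2.2⟩
    rw [h1, h2, min_comm]
  exact profileIneq_second_of_uniformFlat _ s (modelMatroid hE F s r) _ r hunion hdisj
    (by rw [hcard₁]; exact hsF) hrk q hq (by rw [hcard₂]; exact hreg)

/-- **C-025 AT THE CORANK-2 DIAGONAL `(r, r−2)` ON «`U_{r,n}` WITH ONE FAT FLAT `U_{s,k}`»** (night-1's model, `k = #F ≥ s`,
`s ≤ r`, `2r − 2 ≤ s + #(E ∖ F)`): the single row `(r−2, r−1)` through the pointwise bridge. -/
theorem rls_modelMatroid {E : Set α} (hE : E.Finite) {F : Set α} (hF : F ⊆ E) {s r : ℕ}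
    (hsr : s ≤ r) (hsF : s ≤ F.ncard) (hr : 2 ≤ r) (hreg : 2 * r ≤ s + (E \ F).ncard + 2) :
    haveI := modelMatroid_finite hE F s r
    ThmN.RLS (modelMatroid hE F s r) r (r - 2) := by
  haveI := modelMatroid_finite hE F s r
  apply GirthRows.rls_of_profileIneq_rows
  intro u hu1 hu2
  have hu : u = r - 1 := by omega
  subst hu
  exact profileIneq_second_modelMatroid hE hF hsr hsF (r - 2) (by omega) (by omega)

end OneFlat

end PercRepro
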